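import Mathlib.NumberTheory.Padics.PadicIntegers
import Mathlib.NumberTheory.Padics.RingHoms
import Mathlib.LinearAlgebra.Matrix.NonsingularInverse
import Mathlib.LinearAlgebra.FreeModule.PID
import Mathlib.LinearAlgebra.Dimension.Finrank
import Mathlib.Data.Nat.ModEq
import Mathlib.Algebra.BigOperators.Field
import HarnessLib

/-!
# Class number one for `GL_n` over `ℚ`: every system of local lattices comes from one global basis

Topic `Literature/Algebra/Module` (lattices over `ℤ` and `ℤ_p`); Mathlib-only.

**Theorem** (`exists_rat_matrix_rowSpan_eq`, coset form `exists_rat_matrix_mem_integral_coset`).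
Let `T` be a finite set of primes and, for every prime `p`, let `g_p ∈ M_n(ℚ_p)` be invertible, with
`g_p ∈ GL_n(ℤ_p)` for `p ∉ T`. Then there is `γ ∈ GL_n(ℚ)` with `ℤ_pⁿ γ = ℤ_pⁿ g_p` (row spans over
`ℤ_p`) for every prime `p`; equivalently `γ = U_p g_p` with `U_p ∈ GL_n(ℤ_p)` for all `p`.

This is the statement that `GL_n` has class number one over `ℚ`,
`GL_n(𝔸_{ℚ,f}) = GL_n(ℚ) · ∏_p GL_n(ℤ_p)`, or that a `ℤ`-lattice in `ℚⁿ` is determined by, and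
may be prescribed through, its localisations (e.g. Platonov–Rapinchuk, *Algebraic groups and number
theory*, Ch. 8; for `ℚ` it reduces to `ℤ` being a PID). It is the local–global input of
Bhargava–Shankar's computation of the Selmer weights `m(f) = ∏_p m_p(f)` (Prop. 3.6 of the
published version of *Binary quartic forms having bounded invariants…*, Ann. of Math. 181 (2015)):
a collection of local `PGL₂(ℤ_p)`-orbits, integral at all `p` and trivial for almost all `p`, is
realised by one global `PGL₂(ℚ)`-translate which is again integral.

## Proof

Let `L = {v ∈ ℚⁿ : v ∈ ℤ_pⁿ g_p for all p}` (`LocalData.lattice`). With `N = ∏_{p ∈ T} p^K`, `K`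
large enough that `p^K g_p^{±1}` are integral for `p ∈ T`: `N ℤⁿ ⊆ L ⊆ N⁻¹ ℤⁿ`
(`N_smul_intCast_mem_lattice`, `exists_int_eq_N_mul`; a rational that is `p`-integral for all `p`
is an integer). Hence `W = N L ⊆ ℤⁿ` is a subgroup containing `N² ℤⁿ`, free of rank `n` by the
structure theorem over the PID `ℤ` (`Submodule.basisOfPid`, `finrank_intLattice`); a basis gives
`γ` with `L = ℤⁿ γ` (`exists_int_vecMul_gamma_eq`), invertible since `A γ = N · 1` for an integral
`A` (`gamma_det_ne_zero`). Finally `ℤ_pⁿ γ = ℤ_pⁿ g_p` (`rowSpan_gammaP_eq`): `⊆` as the rows lie in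
`L`; `⊇` since `N ℤ_pⁿ ⊆ ℤ_pⁿ γ` and every `w ∈ ℤ_pⁿ g_p` is, modulo `N ℤ_pⁿ`, the image of some
`v ∈ L` — found by `p`-adic approximation of `N w` by integers divisible by `(N/p^K)²`
(Chinese remainder theorem, `exists_nat_dvd_and_norm_sub_le`).

## References

* V. Platonov, A. Rapinchuk, *Algebraic groups and number theory*, Academic Press 1994, Ch. 8
  (class numbers of algebraic groups; `cl(GL_n/ℚ) = 1`). [folklore]
* M. Bhargava, A. Shankar, Ann. of Math. (2) 181 (2015) 191–242, Prop. 3.6 (use).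

## Design

No named facts. Vectors are rows (`Fin n → R`), lattices are `rowSpan p M = span_{ℤ_p}(rows of M)`
inside `ℚ_pⁿ`; the local data are packaged in the structure `LocalData` only to organise the proof.
-/
noncomputable section

open scoped Classical
open Matrix

namespace Literature.Algebra.Module

variable {n : ℕ}

/-! ## Vectors over `ℚ_p`: integrality, row spans -/

section Padic

variable {p : ℕ} [Fact p.Prime]

/-- The embedding `ℚⁿ → ℚ_pⁿ`. [folklore] -/
def ratVec (p : ℕ) [Fact p.Prime] (v : Fin n → ℚ) : Fin n → ℚ_[p] := fun j ↦ (v j : ℚ_[p])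

/-- The embedding `ℤ_pⁿ → ℚ_pⁿ`. [folklore] -/
def intVec (c : Fin n → ℤ_[p]) : Fin n → ℚ_[p] := fun j ↦ (c j : ℚ_[p])

/-- Components of `intVec` (definitional). [folklore] -/
@[simp] theorem intVec_apply (c : Fin n → ℤ_[p]) (j : Fin n) : intVec c j = (c j : ℚ_[p]) := rfl

/-- Components of `ratVec` (definitional). [folklore] -/
@[simp] theorem ratVec_apply (v : Fin n → ℚ) (j : Fin n) : ratVec p v j = (v j : ℚ_[p]) := rfl

/-- A vector of `ℚ_pⁿ` with entries of norm `≤ 1` is the image of a vector of `ℤ_pⁿ`. [folklore] -/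
theorem exists_intVec_of_norm_le {w : Fin n → ℚ_[p]} (hw : ∀ j, ‖w j‖ ≤ 1) :
    ∃ c : Fin n → ℤ_[p], intVec c = w :=
  ⟨fun j ↦ ⟨w j, hw j⟩, rfl⟩

/-- The `ℤ_p`-lattice in `ℚ_pⁿ` spanned by the rows of a matrix. [folklore] -/
def rowSpan (p : ℕ) [Fact p.Prime] (M : Matrix (Fin n) (Fin n) ℚ_[p]) :
    Submodule ℤ_[p] (Fin n → ℚ_[p]) :=
  Submodule.span ℤ_[p] (Set.range M)

/-- Membership in the row span: `w = c M` for an integral row vector `c`. [folklore] -/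
theorem mem_rowSpan_iff (M : Matrix (Fin n) (Fin n) ℚ_[p]) (w : Fin n → ℚ_[p]) :
    w ∈ rowSpan p M ↔ ∃ c : Fin n → ℤ_[p], intVec c ᵥ* M = w := by
  rw [rowSpan, Submodule.mem_span_range_iff_exists_fun]
  have key : ∀ c : Fin n → ℤ_[p], (∑ i, c i • M i) = intVec c ᵥ* M := by
    intro c
    funext j
    simp [Matrix.vecMul, dotProduct, Finset.sum_apply, Algebra.smul_def, intVec]
  constructor
  · rintro ⟨c, hc⟩; exact ⟨c, by rw [← key, hc]⟩
  · rintro ⟨c, hc⟩; exact ⟨c, by rw [key, hc]⟩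

/-- Casting commutes with `vecMul`: `(c B) = c (B)` in `ℚ_p`. [folklore] -/
theorem intVec_vecMul (c : Fin n → ℤ_[p]) (B : Matrix (Fin n) (Fin n) ℤ_[p]) :
    intVec (c ᵥ* B) = intVec c ᵥ* B.map PadicInt.Coe.ringHom := by
  funext j
  simp [intVec, Matrix.vecMul, dotProduct, Matrix.map_apply]

/-- The row span of an integral matrix with unit determinant is all of `ℤ_pⁿ`: every integral
vector lies in it. [folklore] -/
theorem intVec_mem_rowSpan_of_isUnit {B : Matrix (Fin n) (Fin n) ℤ_[p]} (hB : IsUnit B.det)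
    (c : Fin n → ℤ_[p]) : intVec c ∈ rowSpan p (B.map PadicInt.Coe.ringHom) := by
  rw [mem_rowSpan_iff]
  refine ⟨c ᵥ* B⁻¹, ?_⟩
  rw [intVec_vecMul, Matrix.vecMul_vecMul, ← Matrix.map_mul, Matrix.nonsing_inv_mul _ hB,
    Matrix.map_one _ (map_zero _) (map_one _), Matrix.vecMul_one]

/-- Elements of the row span of an integral matrix are integral vectors. [folklore] -/
theorem exists_intVec_eq_of_mem_rowSpan_map {B : Matrix (Fin n) (Fin n) ℤ_[p]} {w : Fin n → ℚ_[p]}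
    (hw : w ∈ rowSpan p (B.map PadicInt.Coe.ringHom)) : ∃ c : Fin n → ℤ_[p], intVec c = w := by
  rw [mem_rowSpan_iff] at hw
  obtain ⟨c, rfl⟩ := hw
  exact ⟨c ᵥ* B, intVec_vecMul c B⟩

end Padic

/-! ## Rationals that are `p`-integral for every `p` are integers -/

/-- A rational number of `p`-adic norm `≤ 1` for every prime `p` is an integer. [folklore] -/
theorem Rat.exists_int_eq_of_forall_padicNorm_le_one (x : ℚ)
    (h : ∀ p : ℕ, p.Prime → padicNorm p x ≤ 1) : ∃ z : ℤ, (z : ℚ) = x := by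
  by_contra hx
  have hden : x.den ≠ 1 := by
    intro h1
    exact hx ⟨x.num, by rw [← Rat.num_div_den x, h1]; simp⟩
  obtain ⟨q, hq, hqd⟩ := Nat.exists_prime_and_dvd hden
  haveI : Fact q.Prime := ⟨hq⟩
  have h1 := h q hq
  -- `‖x‖_q = ‖num‖_q / ‖den‖_q` with `‖num‖_q = 1` (coprime) and `‖den‖_q < 1`
  have hnum : padicNorm q x.num = 1 := by
    have hcop : ¬ (q : ℤ) ∣ x.num := by
      intro hd
      have h2 : q ∣ Nat.gcd x.num.natAbs x.den := Nat.dvd_gcd (Int.ofNat_dvd_left.mp hd) hqd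
      rw [x.reduced.gcd_eq_one] at h2
      exact hq.one_lt.ne' (Nat.dvd_one.mp h2)
    rcases (padicNorm.of_int (p := q) x.num).lt_or_eq with hlt | heq
    · exact absurd ((padicNorm.int_lt_one_iff (p := q) x.num).mp hlt) hcop
    · exact heq
  have hden' : padicNorm q x.den < 1 := by
    have := (padicNorm.int_lt_one_iff (p := q) (x.den : ℤ)).mpr (by exact_mod_cast hqd)
    exact_mod_cast this
  have hden0 : padicNorm q x.den ≠ 0 := fun h0 ↦ by
    have := padicNorm.zero_of_padicNorm_eq_zero h0
    exact x.den_nz (by exact_mod_cast this)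
  have hx' : padicNorm q x = padicNorm q x.num / padicNorm q x.den := by
    conv_lhs => rw [← Rat.num_div_den x]
    rw [padicNorm.div]
  rw [hx', hnum] at h1
  have : 1 < 1 / padicNorm q (x.den : ℚ) := by
    rw [lt_div_iff₀ (lt_of_le_of_ne (padicNorm.nonneg _) hden0.symm), one_mul]
    exact hden'
  linarith


/-! ## Bounded denominators in `ℚ_p`; the integer `N = ∏_{p ∈ T} p^K` -/

section Denominators

variable {p : ℕ} [Fact p.Prime]

/-- Every element of `ℚ_p` becomes integral after multiplication by a power of `p`. [folklore] -/
theorem exists_norm_pow_mul_le_one (x : ℚ_[p]) : ∃ k : ℕ, ‖(p : ℚ_[p]) ^ k * x‖ ≤ 1 := by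
  by_cases hx : x = 0
  · exact ⟨0, by simp [hx]⟩
  have hxpos : 0 < ‖x‖ := norm_pos_iff.mpr hx
  obtain ⟨k, hk⟩ := PadicInt.exists_pow_neg_lt p (inv_pos.mpr hxpos)
  refine ⟨k, ?_⟩
  rw [norm_mul, norm_pow, Padic.norm_p, inv_pow]
  rw [zpow_neg, zpow_natCast] at hk
  have := mul_lt_mul_of_pos_right hk hxpos
  rw [inv_mul_cancel₀ hxpos.ne'] at this
  exact this.le

/-- Multiplying by a further power of `p` keeps integrality. [folklore] -/
theorem norm_pow_mul_le_one_of_le {x : ℚ_[p]} {k k' : ℕ} (hkk : k ≤ k')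
    (h : ‖(p : ℚ_[p]) ^ k * x‖ ≤ 1) : ‖(p : ℚ_[p]) ^ k' * x‖ ≤ 1 := by
  obtain ⟨d, rfl⟩ := Nat.exists_eq_add_of_le hkk
  rw [pow_add, mul_comm ((p : ℚ_[p]) ^ k), mul_assoc, norm_mul]
  calc ‖(p : ℚ_[p]) ^ d‖ * ‖(p : ℚ_[p]) ^ k * x‖ ≤ 1 * 1 := by
        gcongr
        rw [norm_pow, Padic.norm_p, inv_pow]
        exact inv_le_one_of_one_le₀ (one_le_pow₀ (by exact_mod_cast (Fact.out : p.Prime).one_le))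
    _ = 1 := one_mul 1

/-- A finite family of elements of `ℚ_p` becomes integral after multiplication by one power of `p`.
[folklore] -/
theorem exists_norm_pow_mul_le_one_finset (s : Finset ℚ_[p]) :
    ∃ k : ℕ, ∀ x ∈ s, ‖(p : ℚ_[p]) ^ k * x‖ ≤ 1 := by
  induction s using Finset.induction_on with
  | empty => exact ⟨0, by simp⟩
  | insert a s ha ih =>
    obtain ⟨k₁, hk₁⟩ := ih
    obtain ⟨k₂, hk₂⟩ := exists_norm_pow_mul_le_one (p := p) a
    refine ⟨max k₁ k₂, fun x hx ↦ ?_⟩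
    rcases Finset.mem_insert.mp hx with rfl | hx
    · exact norm_pow_mul_le_one_of_le (le_max_right _ _) hk₂
    · exact norm_pow_mul_le_one_of_le (le_max_left _ _) (hk₁ x hx)

/-- The entries of finitely many matrices over `ℚ_p` become integral after multiplication by one
power of `p`. [folklore] -/
theorem exists_norm_pow_mul_entries_le_one (M₁ M₂ : Matrix (Fin n) (Fin n) ℚ_[p]) :
    ∃ k : ℕ, (∀ i j, ‖(p : ℚ_[p]) ^ k * M₁ i j‖ ≤ 1) ∧ (∀ i j, ‖(p : ℚ_[p]) ^ k * M₂ i j‖ ≤ 1) := by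
  obtain ⟨k, hk⟩ := exists_norm_pow_mul_le_one_finset (p := p)
    ((Finset.univ.image fun ij : Fin n × Fin n ↦ M₁ ij.1 ij.2) ∪
      (Finset.univ.image fun ij : Fin n × Fin n ↦ M₂ ij.1 ij.2))
  refine ⟨k, fun i j ↦ hk _ ?_, fun i j ↦ hk _ ?_⟩
  · exact Finset.mem_union_left _ (Finset.mem_image.mpr ⟨(i, j), Finset.mem_univ _, rfl⟩)
  · exact Finset.mem_union_right _ (Finset.mem_image.mpr ⟨(i, j), Finset.mem_univ _, rfl⟩)

/-- **`p`-adic approximation with a divisibility constraint** (Chinese remainder theorem): for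
`m` prime to `p`, every `u ∈ ℤ_p` is within `p^{-k}` of a natural number divisible by `m`.
[folklore] -/
theorem exists_nat_dvd_and_norm_sub_le {m : ℕ} (hm : p.Coprime m) (k : ℕ) (u : ℤ_[p]) :
    ∃ a : ℕ, m ∣ a ∧ ‖((a : ℤ_[p]) - u)‖ ≤ (p : ℝ) ^ (-(k : ℤ)) := by
  obtain ⟨a, ha₁, ha₂⟩ := Nat.chineseRemainder (Nat.Coprime.pow_left k hm) (u.appr k) 0
  refine ⟨a, (Nat.modEq_zero_iff_dvd.mp ha₂), ?_⟩
  -- `a - u = (a - appr) + (appr - u)`, both of norm `≤ p^{-k}`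
  have hdvd : ((p : ℤ) ^ k) ∣ ((a : ℤ) - (u.appr k : ℤ)) := by
    have h := Nat.modEq_iff_dvd.mp ha₁
    push_cast at h
    exact dvd_neg.mp (by rw [neg_sub]; exact h)
  have h1 : ‖(((a : ℤ) - (u.appr k : ℤ) : ℤ) : ℤ_[p])‖ ≤ (p : ℝ) ^ (-(k : ℤ)) :=
    PadicInt.norm_int_le_pow_iff_dvd.mpr hdvd
  have h2 : ‖((u.appr k : ℕ) : ℤ_[p]) - u‖ ≤ (p : ℝ) ^ (-(k : ℤ)) := by
    rw [norm_sub_rev, PadicInt.norm_le_pow_iff_mem_span_pow]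
    exact PadicInt.appr_spec k u
  have hsum : ((a : ℤ_[p]) - u) = (((a : ℤ) - (u.appr k : ℤ) : ℤ) : ℤ_[p]) + (((u.appr k : ℕ) : ℤ_[p]) - u) := by
    push_cast; ring
  rw [hsum]
  exact (PadicInt.nonarchimedean _ _).trans (max_le h1 h2)

end Denominators


/-! ## Integral matrices over `ℚ_p` -/

section IntMatrix

variable {p : ℕ} [Fact p.Prime]

/-- A matrix over `ℚ_p` with entries of norm `≤ 1` is the image of a matrix over `ℤ_p`. [folklore] -/
theorem exists_map_eq_of_norm_le {M : Matrix (Fin n) (Fin n) ℚ_[p]} (hM : ∀ i j, ‖M i j‖ ≤ 1) :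
    ∃ B : Matrix (Fin n) (Fin n) ℤ_[p], B.map PadicInt.Coe.ringHom = M :=
  ⟨fun i j ↦ ⟨M i j, hM i j⟩, by ext i j; rfl⟩

/-- An integral row vector times an integral matrix is integral. [folklore] -/
theorem exists_intVec_vecMul_of_norm_le {c : Fin n → ℚ_[p]} (hc : ∀ i, ‖c i‖ ≤ 1)
    {M : Matrix (Fin n) (Fin n) ℚ_[p]} (hM : ∀ i j, ‖M i j‖ ≤ 1) :
    ∃ c' : Fin n → ℤ_[p], intVec c' = c ᵥ* M := by
  obtain ⟨c₀, rfl⟩ := exists_intVec_of_norm_le hc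
  obtain ⟨B, rfl⟩ := exists_map_eq_of_norm_le hM
  exact ⟨c₀ ᵥ* B, intVec_vecMul c₀ B⟩

/-- Entries of an integral vector have norm `≤ 1`. [folklore] -/
theorem norm_intVec_le (c : Fin n → ℤ_[p]) (j : Fin n) : ‖intVec c j‖ ≤ 1 :=
  (c j).2

/-- Scaling a matrix by `p^K` and by a `p`-adic unit natural number `m`: if `p^K M` is integral
then so is `(m p^K) M`. [folklore] -/
theorem norm_natCast_mul_pow_mul_le {m K : ℕ} (hm : p.Coprime m) {M : Matrix (Fin n) (Fin n) ℚ_[p]}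
    (hM : ∀ i j, ‖(p : ℚ_[p]) ^ K * M i j‖ ≤ 1) (i j : Fin n) :
    ‖(((m * p ^ K : ℕ) : ℚ_[p]) • M) i j‖ ≤ 1 := by
  rw [Matrix.smul_apply, smul_eq_mul, Nat.cast_mul, Nat.cast_pow, mul_assoc, norm_mul,
    Padic.norm_natCast_eq_one_iff.mpr hm, one_mul]
  exact hM i j

end IntMatrix

/-! ## The integer `N = ∏_{q ∈ T} q^K` -/

section BigN

/-- `N = ∏_{q ∈ T} q ^ K`. [folklore] -/
def bigN (T : Finset ℕ) (K : ℕ) : ℕ := ∏ q ∈ T, q ^ K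

variable {T : Finset ℕ} {K : ℕ}

/-- `N > 0` when `T` consists of primes. [folklore] -/
theorem bigN_pos (hT : ∀ q ∈ T, q.Prime) : 0 < bigN T K :=
  Finset.prod_pos fun q hq ↦ pow_pos (hT q hq).pos K

/-- `N = p^K · ∏_{q ∈ T, q ≠ p} q^K` for `p ∈ T`. [folklore] -/
theorem bigN_eq_mul {p : ℕ} (hp : p ∈ T) : bigN T K = (∏ q ∈ T.erase p, q ^ K) * p ^ K := by
  rw [bigN, ← Finset.prod_erase_mul T _ hp]

/-- `p` is prime to `∏_{q ∈ T, q ≠ p} q^K` (distinct primes). [folklore] -/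
theorem coprime_prod_erase {p : ℕ} (hpp : p.Prime) (hT : ∀ q ∈ T, q.Prime) :
    p.Coprime (∏ q ∈ T.erase p, q ^ K) := by
  rw [Nat.coprime_prod_right_iff]
  intro q hq
  obtain ⟨hqp, hqT⟩ := Finset.mem_erase.mp hq
  exact Nat.Coprime.pow_right K ((Nat.coprime_primes hpp (hT q hqT)).mpr (Ne.symm hqp))

/-- `p ∤ N` for a prime `p ∉ T`. [folklore] -/
theorem coprime_bigN_of_not_mem {p : ℕ} (hpp : p.Prime) (hT : ∀ q ∈ T, q.Prime) (hp : p ∉ T) :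
    p.Coprime (bigN T K) := by
  rw [bigN, Nat.coprime_prod_right_iff]
  intro q hq
  exact Nat.Coprime.pow_right K ((Nat.coprime_primes hpp (hT q hq)).mpr (fun h ↦ hp (h ▸ hq)))

/-- `‖N‖_p = 1` for a prime `p ∉ T`. [folklore] -/
theorem norm_bigN_eq_one {p : ℕ} [Fact p.Prime] (hT : ∀ q ∈ T, q.Prime) (hp : p ∉ T) :
    ‖(bigN T K : ℚ_[p])‖ = 1 :=
  Padic.norm_natCast_eq_one_iff.mpr (coprime_bigN_of_not_mem (Fact.out) hT hp)

/-- `‖N‖_p = ‖p^K‖_p = p^{-K}` for `p ∈ T`. [folklore] -/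
theorem norm_bigN_eq_of_mem {p : ℕ} [Fact p.Prime] (hT : ∀ q ∈ T, q.Prime) (hp : p ∈ T) :
    ‖(bigN T K : ℚ_[p])‖ = ‖(p : ℚ_[p]) ^ K‖ := by
  rw [bigN_eq_mul hp, Nat.cast_mul, norm_mul, Padic.norm_natCast_eq_one_iff.mpr
    (coprime_prod_erase (Fact.out) hT), one_mul, Nat.cast_pow]

end BigN

/-! ## Local data and the global lattice `L = {v ∈ ℚⁿ : v ∈ M_p for all p}` -/

/-- A system of local lattices: for every prime `p` an invertible matrix `g_p ∈ M_n(ℚ_p)` whose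
row span `M_p = ℤ_pⁿ g_p` is the prescribed lattice, equal to `ℤ_pⁿ` (i.e. `g_p ∈ GL_n(ℤ_p)`)
outside the finite set `T` of primes, together with an exponent `K` such that `p^K g_p` and
`p^K g_p⁻¹` are integral for `p ∈ T`. [folklore] -/
structure LocalData (n : ℕ) where
  /-- the exceptional primes -/
  T : Finset ℕ
  /-- they are primes -/
  hT : ∀ q ∈ T, q.Prime
  /-- the local matrices -/
  g : ∀ (p : ℕ) [Fact p.Prime], Matrix (Fin n) (Fin n) ℚ_[p]
  /-- they are invertible -/
  hg : ∀ (p : ℕ) [Fact p.Prime], IsUnit (g p).det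
  /-- outside `T` they lie in `GL_n(ℤ_p)` -/
  hout : ∀ (p : ℕ) [Fact p.Prime], p ∉ T →
    ∃ B : Matrix (Fin n) (Fin n) ℤ_[p], IsUnit B.det ∧ B.map PadicInt.Coe.ringHom = g p
  /-- a uniform exponent bounding denominators on `T` -/
  K : ℕ
  /-- `p^K g_p` and `p^K g_p⁻¹` are integral for `p ∈ T` -/
  hK : ∀ (p : ℕ) [Fact p.Prime], p ∈ T →
    (∀ i j, ‖(p : ℚ_[p]) ^ K * g p i j‖ ≤ 1) ∧ (∀ i j, ‖(p : ℚ_[p]) ^ K * (g p)⁻¹ i j‖ ≤ 1)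

namespace LocalData

variable (D : LocalData n)

/-- The integer `N = ∏_{p ∈ T} p^K` of the local data. [folklore] -/
def N : ℕ := bigN D.T D.K

/-- `N > 0`. [folklore] -/
theorem N_pos : 0 < D.N := bigN_pos D.hT

/-- `N ≠ 0` in `ℚ`. [folklore] -/
theorem N_ne_zero : (D.N : ℚ) ≠ 0 := by exact_mod_cast D.N_pos.ne'

/-- `N · g_p` is integral for `p ∈ T`. [folklore] -/
theorem norm_N_mul_g_le {p : ℕ} [Fact p.Prime] (hp : p ∈ D.T) (i j : Fin n) :
    ‖((D.N : ℚ_[p]) • D.g p) i j‖ ≤ 1 := by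
  have h := norm_natCast_mul_pow_mul_le (coprime_prod_erase (K := D.K) (Fact.out) D.hT)
    (D.hK p hp).1 i j
  rwa [← bigN_eq_mul hp] at h

/-- `N · g_p⁻¹` is integral for `p ∈ T`. [folklore] -/
theorem norm_N_mul_g_inv_le {p : ℕ} [Fact p.Prime] (hp : p ∈ D.T) (i j : Fin n) :
    ‖((D.N : ℚ_[p]) • (D.g p)⁻¹) i j‖ ≤ 1 := by
  have h := norm_natCast_mul_pow_mul_le (coprime_prod_erase (K := D.K) (Fact.out) D.hT)
    (D.hK p hp).2 i j
  rwa [← bigN_eq_mul hp] at h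

/-- **The global lattice** `L = {v ∈ ℚⁿ : v ∈ ℤ_pⁿ g_p for every prime p}`. [folklore] -/
def lattice : Submodule ℤ (Fin n → ℚ) where
  carrier := {v | ∀ (p : ℕ) [Fact p.Prime], ratVec p v ∈ rowSpan p (D.g p)}
  add_mem' {v w} hv hw p _ := by
    have : ratVec p (v + w) = ratVec p v + ratVec p w := by
      funext j; simp [ratVec]
    rw [this]; exact Submodule.add_mem _ (hv p) (hw p)
  zero_mem' p _ := by
    have : ratVec p (0 : Fin n → ℚ) = 0 := by funext j; simp [ratVec]
    rw [this]; exact Submodule.zero_mem _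
  smul_mem' z v hv p _ := by
    have : ratVec p (z • v) = (z : ℤ_[p]) • ratVec p v := by
      funext j; simp [ratVec, Algebra.smul_def]
    rw [this]; exact Submodule.smul_mem _ _ (hv p)

/-- Membership in `L` (definitional). [folklore] -/
theorem mem_lattice_iff (v : Fin n → ℚ) :
    v ∈ D.lattice ↔ ∀ (p : ℕ) [Fact p.Prime], ratVec p v ∈ rowSpan p (D.g p) := Iff.rfl

/-- Casting an integer vector and scaling: `ratVec (N • w) = N • ratVec w`. [folklore] -/
theorem ratVec_natCast_smul (p : ℕ) [Fact p.Prime] (N : ℕ) (v : Fin n → ℚ) :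
    ratVec p ((N : ℚ) • v) = (N : ℚ_[p]) • ratVec p v := by
  funext j; simp [ratVec]

/-- **`N ℤⁿ ⊆ L`.** [folklore] -/
theorem N_smul_intCast_mem_lattice (w : Fin n → ℤ) :
    (D.N : ℚ) • (fun j ↦ (w j : ℚ)) ∈ D.lattice := by
  intro p _
  rw [ratVec_natCast_smul]
  by_cases hp : p ∈ D.T
  · -- `c := w (N g_p⁻¹)` is integral and `c g_p = N w`
    rw [mem_rowSpan_iff]
    have hw : ∀ i, ‖ratVec p (fun j ↦ (w j : ℚ)) i‖ ≤ 1 := fun i ↦ by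
      simpa [ratVec] using Padic.norm_int_le_one (p := p) (w i)
    obtain ⟨c, hc⟩ := exists_intVec_vecMul_of_norm_le hw (D.norm_N_mul_g_inv_le hp)
    refine ⟨c, ?_⟩
    rw [hc, Matrix.vecMul_vecMul, Matrix.smul_mul, Matrix.nonsing_inv_mul _ (D.hg p),
      Matrix.vecMul_smul, Matrix.vecMul_one]
  · obtain ⟨B, hB, hBg⟩ := D.hout p hp
    rw [← hBg]
    have hw : ∀ i, ‖((D.N : ℚ_[p]) • ratVec p (fun j ↦ (w j : ℚ))) i‖ ≤ 1 := fun i ↦ by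
      simp only [Pi.smul_apply, smul_eq_mul, norm_mul, ratVec]
      calc ‖(D.N : ℚ_[p])‖ * ‖((w i : ℚ) : ℚ_[p])‖ ≤ 1 * 1 := by
            gcongr
            · simpa using Padic.norm_int_le_one (p := p) (D.N : ℤ)
            · simpa using Padic.norm_int_le_one (p := p) (w i)
        _ = 1 := one_mul 1
    obtain ⟨c, hc⟩ := exists_intVec_of_norm_le hw
    rw [← hc]
    exact intVec_mem_rowSpan_of_isUnit hB c

/-- **`L ⊆ N⁻¹ ℤⁿ`**: `N v` has integer coordinates for `v ∈ L`. [folklore] -/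
theorem exists_int_eq_N_mul {v : Fin n → ℚ} (hv : v ∈ D.lattice) (j : Fin n) :
    ∃ z : ℤ, (z : ℚ) = D.N * v j := by
  refine Rat.exists_int_eq_of_forall_padicNorm_le_one _ fun p hpp ↦ ?_
  haveI : Fact p.Prime := ⟨hpp⟩
  have key : ‖(((D.N : ℚ) * v j : ℚ) : ℚ_[p])‖ ≤ 1 := by
    have hvp := hv p
    rw [mem_rowSpan_iff] at hvp
    obtain ⟨c, hc⟩ := hvp
    by_cases hp : p ∈ D.T
    · -- `N v = c (N g_p)` is integral
      obtain ⟨c', hc'⟩ := exists_intVec_vecMul_of_norm_le (norm_intVec_le c) (D.norm_N_mul_g_le hp)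
      have : (((D.N : ℚ) * v j : ℚ) : ℚ_[p]) = (intVec c ᵥ* ((D.N : ℚ_[p]) • D.g p)) j := by
        rw [Matrix.vecMul_smul, hc]; simp [ratVec]
      rw [this, ← hc']
      exact norm_intVec_le c' j
    · obtain ⟨B, hB, hBg⟩ := D.hout p hp
      rw [← hBg, ← intVec_vecMul] at hc
      have h1 : ‖ratVec p v j‖ ≤ 1 := by rw [← hc]; exact norm_intVec_le _ j
      push_cast
      rw [norm_mul]
      calc ‖((D.N : ℚ) : ℚ_[p])‖ * ‖((v j : ℚ) : ℚ_[p])‖ ≤ 1 * 1 := by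
            gcongr
            · simpa using Padic.norm_int_le_one (p := p) (D.N : ℤ)
            · exact h1
        _ = 1 := one_mul 1
  rw [Padic.eq_padicNorm] at key
  exact_mod_cast key


/-! ## `L` is free of rank `n`: the integer lattice `W = N · L ⊆ ℤⁿ` and the global matrix `γ` -/

/-- `W = {w ∈ ℤⁿ : N⁻¹ w ∈ L}` (so that `L = N⁻¹ W`). [folklore] -/
def intLattice : Submodule ℤ (Fin n → ℤ) where
  carrier := {w | (fun j ↦ (w j : ℚ) / D.N) ∈ D.lattice}
  add_mem' {v w} hv hw := by
    have : (fun j ↦ ((v + w) j : ℚ) / D.N) = (fun j ↦ (v j : ℚ) / D.N) + fun j ↦ (w j : ℚ) / D.N := by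
      funext j; simp [add_div]
    show (fun j ↦ ((v + w) j : ℚ) / D.N) ∈ D.lattice
    rw [this]; exact Submodule.add_mem _ hv hw
  zero_mem' := by
    have : (fun j ↦ ((0 : Fin n → ℤ) j : ℚ) / D.N) = 0 := by funext j; simp
    show (fun j ↦ ((0 : Fin n → ℤ) j : ℚ) / D.N) ∈ D.lattice
    rw [this]; exact Submodule.zero_mem _
  smul_mem' z w hw := by
    have : (fun j ↦ ((z • w) j : ℚ) / D.N) = z • fun j ↦ (w j : ℚ) / D.N := by
      funext j; simp [mul_div_assoc]
    show (fun j ↦ ((z • w) j : ℚ) / D.N) ∈ D.lattice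
    rw [this]; exact Submodule.smul_mem _ _ hw

/-- Membership in `W` (definitional). [folklore] -/
theorem mem_intLattice_iff (w : Fin n → ℤ) :
    w ∈ D.intLattice ↔ (fun j ↦ (w j : ℚ) / D.N) ∈ D.lattice := Iff.rfl

/-- **`N² ℤⁿ ⊆ W`.** [folklore] -/
theorem sq_smul_mem_intLattice (w : Fin n → ℤ) : ((D.N : ℤ) ^ 2) • w ∈ D.intLattice := by
  rw [mem_intLattice_iff]
  have hN := D.N_ne_zero
  have : (fun j ↦ ((((D.N : ℤ) ^ 2) • w) j : ℚ) / D.N) = (D.N : ℚ) • fun j ↦ (w j : ℚ) := by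
    funext j
    simp only [Pi.smul_apply, smul_eq_mul, Int.cast_mul, Int.cast_pow, Int.cast_natCast]
    field_simp
  rw [this]
  exact D.N_smul_intCast_mem_lattice w

/-- `L = N⁻¹ W`. [folklore] -/
theorem mem_lattice_iff_exists_intLattice (v : Fin n → ℚ) :
    v ∈ D.lattice ↔ ∃ w ∈ D.intLattice, v = fun j ↦ (w j : ℚ) / D.N := by
  constructor
  · intro hv
    choose z hz using fun j ↦ D.exists_int_eq_N_mul hv j
    have hv' : v = fun j ↦ (z j : ℚ) / D.N := by
      funext j
      show v j = (z j : ℚ) / D.N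
      rw [hz j, mul_div_cancel_left₀ _ D.N_ne_zero]
    refine ⟨z, ?_, hv'⟩
    rw [mem_intLattice_iff, ← hv']; exact hv
  · rintro ⟨w, hw, rfl⟩; exact hw

/-- **`W` has rank `n`** (`N² ℤⁿ ⊆ W ⊆ ℤⁿ`). [folklore] -/
theorem finrank_intLattice : Module.finrank ℤ D.intLattice = n := by
  apply le_antisymm
  · calc Module.finrank ℤ D.intLattice ≤ Module.finrank ℤ (Fin n → ℤ) := Submodule.finrank_le _
      _ = n := by rw [Module.finrank_fintype_fun_eq_card, Fintype.card_fin]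
  · let f : (Fin n → ℤ) →ₗ[ℤ] (Fin n → ℤ) := ((D.N : ℤ) ^ 2) • LinearMap.id
    have hN : ((D.N : ℤ) ^ 2) ≠ 0 := pow_ne_zero 2 (by exact_mod_cast D.N_pos.ne')
    have hf : Function.Injective f := fun a b h ↦ by
      funext j
      have := congrFun h j
      simp only [f, LinearMap.smul_apply, LinearMap.id_apply, Pi.smul_apply, smul_eq_mul] at this
      exact mul_left_cancel₀ hN this
    have hle : LinearMap.range f ≤ D.intLattice := by
      rintro _ ⟨w, rfl⟩; exact D.sq_smul_mem_intLattice w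
    calc n = Module.finrank ℤ (Fin n → ℤ) := by
          rw [Module.finrank_fintype_fun_eq_card, Fintype.card_fin]
      _ = Module.finrank ℤ (LinearMap.range f) := (LinearMap.finrank_range_of_inj hf).symm
      _ ≤ Module.finrank ℤ D.intLattice := Submodule.finrank_mono hle

/-- A `ℤ`-basis of `W` indexed by `Fin n` (structure theorem over the PID `ℤ`). [folklore] -/
def intBasis : Module.Basis (Fin n) ℤ D.intLattice :=
  let b := Submodule.basisOfPid (Pi.basisFun ℤ (Fin n)) D.intLattice
  b.2.reindex (finCongr (by
    have h := Module.finrank_eq_card_basis b.2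
    rw [finrank_intLattice, Fintype.card_fin] at h
    exact h.symm))

/-- **The global matrix `γ`**: its rows `N⁻¹ b_i` form a `ℤ`-basis of `L`, `(b_i)` a basis of `W`.
[folklore] -/
def gamma : Matrix (Fin n) (Fin n) ℚ := fun i j ↦ ((D.intBasis i : Fin n → ℤ) j : ℚ) / D.N

/-- The rows of `γ` lie in `L`. [folklore] -/
theorem gamma_mem_lattice (i : Fin n) : D.gamma i ∈ D.lattice :=
  (D.mem_lattice_iff_exists_intLattice _).mpr ⟨_, (D.intBasis i).2, rfl⟩

/-- **`L = ℤⁿ γ`**: every `v ∈ L` is an integer combination of the rows of `γ`. [folklore] -/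
theorem exists_int_vecMul_gamma_eq {v : Fin n → ℚ} (hv : v ∈ D.lattice) :
    ∃ a : Fin n → ℤ, (fun i ↦ (a i : ℚ)) ᵥ* D.gamma = v := by
  obtain ⟨w, hw, rfl⟩ := (D.mem_lattice_iff_exists_intLattice v).mp hv
  refine ⟨fun i ↦ D.intBasis.repr ⟨w, hw⟩ i, ?_⟩
  have hsum : (∑ i, (D.intBasis.repr ⟨w, hw⟩ i) • D.intBasis i) = (⟨w, hw⟩ : D.intLattice) :=
    D.intBasis.sum_repr ⟨w, hw⟩
  have hsum' : (∑ i, (D.intBasis.repr ⟨w, hw⟩ i) • (D.intBasis i : Fin n → ℤ)) = w := by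
    have h := congrArg D.intLattice.subtype hsum
    simpa only [map_sum, map_smul, Submodule.subtype_apply] using h
  funext j
  have hj := congrFun hsum' j
  simp only [Finset.sum_apply, Pi.smul_apply, smul_eq_mul] at hj
  simp only [Matrix.vecMul, dotProduct, gamma]
  rw [← hj]
  push_cast
  rw [Finset.sum_div]
  refine Finset.sum_congr rfl fun i _ ↦ ?_
  ring

/-- **`γ` is invertible**: `A γ = N · 1` for an integral `A` (as `N e_j ∈ L = ℤⁿγ`). [folklore] -/
theorem gamma_det_ne_zero : D.gamma.det ≠ 0 := by
  have hrow : ∀ j : Fin n, ∃ a : Fin n → ℤ,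
      (fun i ↦ (a i : ℚ)) ᵥ* D.gamma = (D.N : ℚ) • fun k ↦ ((Pi.single j 1 : Fin n → ℤ) k : ℚ) :=
    fun j ↦ D.exists_int_vecMul_gamma_eq (D.N_smul_intCast_mem_lattice (Pi.single j 1))
  choose a ha using hrow
  set A : Matrix (Fin n) (Fin n) ℚ := fun j i ↦ (a j i : ℚ) with hA
  have hAγ : A * D.gamma = (D.N : ℚ) • (1 : Matrix (Fin n) (Fin n) ℚ) := by
    ext j k
    have := congrFun (ha j) k
    simp only [Matrix.vecMul, dotProduct, Pi.smul_apply, smul_eq_mul] at this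
    rw [Matrix.mul_apply, Matrix.smul_apply, Matrix.one_apply, this]
    by_cases hjk : j = k
    · subst hjk; simp
    · simp [hjk, Ne.symm hjk]
  intro hdet
  have := congrArg Matrix.det hAγ
  rw [Matrix.det_mul, hdet, mul_zero, Matrix.det_smul, Matrix.det_one, mul_one,
    Fintype.card_fin] at this
  exact pow_ne_zero n D.N_ne_zero this.symm


/-! ## The localisations of `ℤⁿ γ` are the prescribed lattices -/

/-- `γ` over `ℚ_p`. [folklore] -/
def gammaP (p : ℕ) [Fact p.Prime] : Matrix (Fin n) (Fin n) ℚ_[p] :=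
  D.gamma.map fun x : ℚ ↦ (x : ℚ_[p])

/-- The rows of `γ` over `ℚ_p` are the casts of the rows of `γ` (definitional). [folklore] -/
theorem gammaP_row (p : ℕ) [Fact p.Prime] (i : Fin n) : D.gammaP p i = ratVec p (D.gamma i) := rfl

/-- Step (i): `v ∈ L ⇒ v ∈ ℤ_pⁿ γ`. [folklore] -/
theorem ratVec_mem_rowSpan_gammaP {v : Fin n → ℚ} (hv : v ∈ D.lattice) (p : ℕ) [Fact p.Prime] :
    ratVec p v ∈ rowSpan p (D.gammaP p) := by
  obtain ⟨a, rfl⟩ := D.exists_int_vecMul_gamma_eq hv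
  rw [mem_rowSpan_iff]
  refine ⟨fun i ↦ (a i : ℤ_[p]), ?_⟩
  funext j
  simp only [Matrix.vecMul, dotProduct, ratVec_apply, intVec_apply, gammaP, Matrix.map_apply,
    PadicInt.coe_intCast]
  push_cast
  rfl

/-- Step (ii), local sandwich: `N ℤ_pⁿ ⊆ ℤ_pⁿ g_p` for every `p`. [folklore] -/
theorem N_smul_intVec_mem_rowSpan (p : ℕ) [Fact p.Prime] (c : Fin n → ℤ_[p]) :
    (D.N : ℚ_[p]) • intVec c ∈ rowSpan p (D.g p) := by
  by_cases hp : p ∈ D.T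
  · rw [mem_rowSpan_iff]
    obtain ⟨c', hc'⟩ := exists_intVec_vecMul_of_norm_le (norm_intVec_le c) (D.norm_N_mul_g_inv_le hp)
    refine ⟨c', ?_⟩
    rw [hc', Matrix.vecMul_vecMul, Matrix.smul_mul, Matrix.nonsing_inv_mul _ (D.hg p),
      Matrix.vecMul_smul, Matrix.vecMul_one]
  · obtain ⟨B, hB, hBg⟩ := D.hout p hp
    rw [← hBg]
    have : (D.N : ℚ_[p]) • intVec c = intVec (fun j ↦ (D.N : ℤ_[p]) * c j) := by
      funext j; simp [intVec]
    rw [this]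
    exact intVec_mem_rowSpan_of_isUnit hB _

/-- Step (ii'): `N ℤ_pⁿ ⊆ ℤ_pⁿ γ`. [folklore] -/
theorem N_smul_intVec_mem_rowSpan_gammaP (p : ℕ) [Fact p.Prime] (c : Fin n → ℤ_[p]) :
    (D.N : ℚ_[p]) • intVec c ∈ rowSpan p (D.gammaP p) := by
  have hexp : (D.N : ℚ_[p]) • intVec c =
      ∑ j, c j • ratVec p ((D.N : ℚ) • fun k ↦ ((Pi.single j 1 : Fin n → ℤ) k : ℚ)) := by
    funext k
    simp only [Pi.smul_apply, smul_eq_mul, intVec_apply, Finset.sum_apply, Algebra.smul_def]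
    rw [Finset.sum_eq_single k]
    · simp [mul_comm]
    · intro j _ hjk
      simp [Pi.single_eq_of_ne (Ne.symm hjk)]
    · intro hk; exact absurd (Finset.mem_univ k) hk
  rw [hexp]
  exact Submodule.sum_mem _ fun j _ ↦
    Submodule.smul_mem _ _ (D.ratVec_mem_rowSpan_gammaP (D.N_smul_intCast_mem_lattice _) p)


/-- `‖N‖_p = p^{-K}` for `p ∈ T`. [folklore] -/
theorem norm_N_of_mem {p : ℕ} [Fact p.Prime] (hp : p ∈ D.T) :
    ‖(D.N : ℚ_[p])‖ = ((p : ℝ) ^ D.K)⁻¹ := by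
  rw [LocalData.N, norm_bigN_eq_of_mem D.hT hp, norm_pow, Padic.norm_p, inv_pow]

/-- For `q ∈ T`, `q ≠ p`: `q^{2K}` divides `m_p = (∏_{r ∈ T, r ≠ p} r^K)²`. [folklore] -/
theorem pow_dvd_sq_prod_erase {p q : ℕ} (hq : q ∈ D.T) (hqp : q ≠ p) :
    q ^ (2 * D.K) ∣ (∏ r ∈ D.T.erase p, r ^ D.K) ^ 2 := by
  rw [pow_mul, ← pow_mul, mul_comm, pow_mul]
  exact pow_dvd_pow_of_dvd (Finset.dvd_prod_of_mem (fun r ↦ r ^ D.K) (Finset.mem_erase.mpr ⟨hqp, hq⟩)) 2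

/-- **The localisation of `ℤⁿ γ` at `p` is `ℤ_pⁿ g_p`.** [folklore] -/
theorem rowSpan_gammaP_eq (p : ℕ) [Fact p.Prime] : rowSpan p (D.gammaP p) = rowSpan p (D.g p) := by
  apply le_antisymm
  · rw [rowSpan, Submodule.span_le]
    rintro _ ⟨i, rfl⟩
    exact D.gamma_mem_lattice i p
  intro w hw
  by_cases hp : p ∈ D.T
  · -- `u = N w = c₁` is integral
    obtain ⟨c, hc⟩ := (mem_rowSpan_iff _ _).mp hw
    obtain ⟨c₁, hc₁⟩ := exists_intVec_vecMul_of_norm_le (norm_intVec_le c) (D.norm_N_mul_g_le hp)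
    have hu : intVec c₁ = (D.N : ℚ_[p]) • w := by rw [hc₁, Matrix.vecMul_smul, hc]
    have hNp : (D.N : ℚ_[p]) ≠ 0 := by exact_mod_cast D.N_pos.ne'
    have hppos : (0 : ℝ) < p := by exact_mod_cast (Fact.out : p.Prime).pos
    -- approximate `c₁` by naturals divisible by `m = (∏_{q ≠ p} q^K)²`, to precision `p^{-2K}`
    have hcop : p.Coprime ((∏ r ∈ D.T.erase p, r ^ D.K) ^ 2) :=
      Nat.Coprime.pow_right 2 (coprime_prod_erase (Fact.out) D.hT)
    choose a ha_dvd ha_norm using fun j ↦ exists_nat_dvd_and_norm_sub_le hcop (2 * D.K) (c₁ j)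
    -- the global vector `v = a / N`
    set v : Fin n → ℚ := fun j ↦ (a j : ℚ) / D.N with hv
    -- `d = (a - c₁)/N²` is `p`-integral and `v = w + N d` at `p`
    have hd : ∀ j, ‖((a j : ℚ_[p]) - (c₁ j : ℚ_[p])) / (D.N : ℚ_[p]) ^ 2‖ ≤ 1 := by
      intro j
      have h1 : ‖(a j : ℚ_[p]) - (c₁ j : ℚ_[p])‖ ≤ (p : ℝ) ^ (-((2 * D.K : ℕ) : ℤ)) := by
        have := ha_norm j
        rwa [PadicInt.norm_def, PadicInt.coe_sub, PadicInt.coe_natCast] at this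
      rw [norm_div, norm_pow, D.norm_N_of_mem hp, div_le_one (by positivity)]
      refine h1.trans (le_of_eq ?_)
      rw [zpow_neg, zpow_natCast, inv_pow]
      ring
    obtain ⟨d, hd'⟩ := exists_intVec_of_norm_le hd
    have hwj : ∀ j, w j = (c₁ j : ℚ_[p]) / D.N := fun j ↦ by
      have := congrFun hu j
      simp only [intVec_apply, Pi.smul_apply, smul_eq_mul] at this
      rw [this, mul_div_cancel_left₀ _ hNp]
    have hdecomp : ratVec p v = w + (D.N : ℚ_[p]) • intVec d := by
      funext j
      rw [Pi.add_apply, Pi.smul_apply, hd', hwj, ratVec_apply, hv, smul_eq_mul]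
      push_cast
      field_simp
      ring
    -- `v ∈ L`
    have hvL : v ∈ D.lattice := by
      intro q _
      by_cases hqp : q = p
      · subst hqp
        rw [hdecomp]
        exact Submodule.add_mem _ hw (D.N_smul_intVec_mem_rowSpan q d)
      · by_cases hqT : q ∈ D.T
        · have hNq : (D.N : ℚ_[q]) ≠ 0 := by exact_mod_cast D.N_pos.ne'
          have hqpos : (0 : ℝ) < q := by exact_mod_cast (Fact.out : q.Prime).pos
          have hint : ∀ j, ‖(a j : ℚ_[q]) / (D.N : ℚ_[q]) ^ 2‖ ≤ 1 := by
            intro j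
            have hdvd : ((q : ℤ) ^ (2 * D.K)) ∣ (a j : ℤ) := by
              exact_mod_cast (pow_dvd_sq_prod_erase D hqT hqp).trans (ha_dvd j)
            have h1 : ‖(a j : ℚ_[q])‖ ≤ (q : ℝ) ^ (-((2 * D.K : ℕ) : ℤ)) := by
              have := (Padic.norm_int_le_pow_iff_dvd (a j : ℤ) (2 * D.K)).mpr hdvd
              simpa using this
            rw [norm_div, norm_pow, D.norm_N_of_mem hqT, div_le_one (by positivity)]
            refine h1.trans (le_of_eq ?_)
            rw [zpow_neg, zpow_natCast, inv_pow]
            ring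
          obtain ⟨d', hd''⟩ := exists_intVec_of_norm_le hint
          have : ratVec q v = (D.N : ℚ_[q]) • intVec d' := by
            funext j
            rw [Pi.smul_apply, hd'', ratVec_apply, hv, smul_eq_mul]
            push_cast
            field_simp
          rw [this]
          exact D.N_smul_intVec_mem_rowSpan q d'
        · obtain ⟨B, hB, hBg⟩ := D.hout q hqT
          have hint : ∀ j, ‖ratVec q v j‖ ≤ 1 := fun j ↦ by
            rw [ratVec_apply, hv]
            push_cast
            rw [norm_div, LocalData.N, norm_bigN_eq_one D.hT hqT, div_one]
            simpa using Padic.norm_int_le_one (p := q) (a j : ℤ)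
          obtain ⟨d', hd''⟩ := exists_intVec_of_norm_le hint
          rw [← hBg, ← hd'']
          exact intVec_mem_rowSpan_of_isUnit hB d'
    -- conclude: `w = v - N d ∈ ℤ_pⁿ γ`
    have h1 := D.ratVec_mem_rowSpan_gammaP hvL p
    have h2 := D.N_smul_intVec_mem_rowSpan_gammaP p d
    have : w = ratVec p v - (D.N : ℚ_[p]) • intVec d := by rw [hdecomp]; abel
    rw [this]
    exact Submodule.sub_mem _ h1 h2
  · -- `p ∉ T`: `w` is integral and `N` is a `p`-adic unit
    obtain ⟨B, hB, hBg⟩ := D.hout p hp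
    rw [← hBg] at hw
    obtain ⟨c, rfl⟩ := exists_intVec_eq_of_mem_rowSpan_map hw
    have hN1 : ‖(D.N : ℤ_[p])‖ = 1 := by
      rw [PadicInt.norm_def, PadicInt.coe_natCast, LocalData.N]
      exact norm_bigN_eq_one D.hT hp
    obtain ⟨u, hu⟩ := PadicInt.isUnit_iff.mpr hN1
    have : intVec c = (D.N : ℚ_[p]) • intVec (fun j ↦ ((u⁻¹ : ℤ_[p]ˣ) : ℤ_[p]) * c j) := by
      funext j
      simp only [intVec_apply, Pi.smul_apply, smul_eq_mul, PadicInt.coe_mul]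
      rw [← mul_assoc, ← PadicInt.coe_natCast, ← hu, ← PadicInt.coe_mul, Units.mul_inv, PadicInt.coe_one,
        one_mul]
    rw [this]
    exact D.N_smul_intVec_mem_rowSpan_gammaP p _


end LocalData

/-! ## The theorem -/

/-- **Class number one for `GL_n` over `ℚ`** (`GL_n(𝔸_{ℚ,f}) = GL_n(ℚ) · ∏_p GL_n(ℤ_p)`), in
lattice form: given, for every prime `p`, an invertible `g_p ∈ M_n(ℚ_p)`, lying in `GL_n(ℤ_p)` for
all `p` outside a finite set `T`, there is one rational matrix `γ ∈ GL_n(ℚ)` whose rows span, over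
every `ℤ_p`, the same lattice as the rows of `g_p`: `ℤ_pⁿ γ = ℤ_pⁿ g_p` for all `p`. (Equivalently:
the `ℤ`-lattice `L = {v ∈ ℚⁿ : v ∈ ℤ_pⁿ g_p ∀ p}` is free of rank `n`, with basis the rows of `γ`,
and has the prescribed localisations.) [folklore] -/
theorem exists_rat_matrix_rowSpan_eq (T : Finset ℕ) (hT : ∀ q ∈ T, q.Prime)
    (g : ∀ (p : ℕ) [Fact p.Prime], Matrix (Fin n) (Fin n) ℚ_[p])
    (hg : ∀ (p : ℕ) [Fact p.Prime], IsUnit (g p).det)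
    (hout : ∀ (p : ℕ) [Fact p.Prime], p ∉ T →
      ∃ B : Matrix (Fin n) (Fin n) ℤ_[p], IsUnit B.det ∧ B.map PadicInt.Coe.ringHom = g p) :
    ∃ γ : Matrix (Fin n) (Fin n) ℚ, γ.det ≠ 0 ∧ ∀ (p : ℕ) [Fact p.Prime],
      rowSpan p (γ.map fun x : ℚ ↦ (x : ℚ_[p])) = rowSpan p (g p) := by
  -- a uniform exponent bounding the denominators of `g_p^{±1}`, `p ∈ T`
  have hk : ∀ (p : ℕ) (hp : p.Prime), ∃ k : ℕ, (haveI : Fact p.Prime := ⟨hp⟩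
      (∀ i j, ‖(p : ℚ_[p]) ^ k * g p i j‖ ≤ 1) ∧ (∀ i j, ‖(p : ℚ_[p]) ^ k * (g p)⁻¹ i j‖ ≤ 1)) :=
    fun p hp ↦ by
      haveI : Fact p.Prime := ⟨hp⟩
      exact exists_norm_pow_mul_entries_le_one (g p) (g p)⁻¹
  choose k hk using hk
  let kf : ℕ → ℕ := fun p ↦ if hp : p.Prime then k p hp else 0
  let D : LocalData n :=
    { T := T
      hT := hT
      g := fun p _ ↦ g p
      hg := fun p _ ↦ hg p
      hout := fun p _ ↦ hout p
      K := T.sup kf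
      hK := fun p inst hp ↦ by
        have hpp : p.Prime := inst.out
        have hle : k p hpp ≤ T.sup kf := by
          have : kf p ≤ T.sup kf := Finset.le_sup hp
          simpa [kf, hpp] using this
        obtain ⟨h1, h2⟩ := hk p hpp
        exact ⟨fun i j ↦ norm_pow_mul_le_one_of_le hle (h1 i j),
          fun i j ↦ norm_pow_mul_le_one_of_le hle (h2 i j)⟩ }
  exact ⟨D.gamma, D.gamma_det_ne_zero, fun p _ ↦ D.rowSpan_gammaP_eq p⟩

/-- Rows in a row span: the whole matrix is a left multiple by an integral matrix. [folklore] -/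
theorem exists_int_matrix_mul_eq_of_rows_mem {p : ℕ} [Fact p.Prime]
    {A M : Matrix (Fin n) (Fin n) ℚ_[p]} (h : ∀ i, A i ∈ rowSpan p M) :
    ∃ U : Matrix (Fin n) (Fin n) ℤ_[p], U.map PadicInt.Coe.ringHom * M = A := by
  choose c hc using fun i ↦ (mem_rowSpan_iff M (A i)).mp (h i)
  refine ⟨fun i k ↦ c i k, ?_⟩
  ext i j
  have := congrFun (hc i) j
  simp only [Matrix.vecMul, dotProduct, intVec_apply] at this
  simpa [Matrix.mul_apply] using this

/-- **Class number one for `GL_n` over `ℚ`, coset form**: with `γ` as above, `γ ∈ GL_n(ℤ_p) g_p`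
for every prime `p`, i.e. `γ = U_p g_p` with `U_p ∈ GL_n(ℤ_p)`. [folklore] -/
theorem exists_rat_matrix_mem_integral_coset (T : Finset ℕ) (hT : ∀ q ∈ T, q.Prime)
    (g : ∀ (p : ℕ) [Fact p.Prime], Matrix (Fin n) (Fin n) ℚ_[p])
    (hg : ∀ (p : ℕ) [Fact p.Prime], IsUnit (g p).det)
    (hout : ∀ (p : ℕ) [Fact p.Prime], p ∉ T →
      ∃ B : Matrix (Fin n) (Fin n) ℤ_[p], IsUnit B.det ∧ B.map PadicInt.Coe.ringHom = g p) :
    ∃ γ : Matrix (Fin n) (Fin n) ℚ, γ.det ≠ 0 ∧ ∀ (p : ℕ) [Fact p.Prime],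
      ∃ U : Matrix (Fin n) (Fin n) ℤ_[p], IsUnit U.det ∧
        (γ.map fun x : ℚ ↦ (x : ℚ_[p])) = U.map PadicInt.Coe.ringHom * g p := by
  obtain ⟨γ, hγ, hspan⟩ := exists_rat_matrix_rowSpan_eq T hT g hg hout
  refine ⟨γ, hγ, fun p _ ↦ ?_⟩
  set γP : Matrix (Fin n) (Fin n) ℚ_[p] := γ.map fun x : ℚ ↦ (x : ℚ_[p]) with hγP
  have h1 : ∀ i, γP i ∈ rowSpan p (g p) := fun i ↦ by
    rw [← hspan p]; exact Submodule.subset_span ⟨i, rfl⟩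
  have h2 : ∀ i, g p i ∈ rowSpan p γP := fun i ↦ by
    rw [hspan p]; exact Submodule.subset_span ⟨i, rfl⟩
  obtain ⟨U, hU⟩ := exists_int_matrix_mul_eq_of_rows_mem h1
  obtain ⟨V, hV⟩ := exists_int_matrix_mul_eq_of_rows_mem h2
  refine ⟨U, ?_, hU.symm⟩
  -- `U V = 1` since `γP = U V γP` with `γP` invertible
  have hγP : IsUnit γP.det := by
    rw [hγP, show (fun x : ℚ ↦ (x : ℚ_[p])) = (Rat.castHom ℚ_[p] : ℚ → ℚ_[p]) from rfl,
      ← RingHom.mapMatrix_apply, ← RingHom.map_det, isUnit_iff_ne_zero]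
    exact (map_ne_zero _).mpr hγ
  have hUV : (U * V).map PadicInt.Coe.ringHom = 1 := by
    have h : (U.map PadicInt.Coe.ringHom * V.map PadicInt.Coe.ringHom) * γP = 1 * γP := by
      rw [Matrix.mul_assoc, hV, hU, Matrix.one_mul]
    have h' := congrArg (· * γP⁻¹) h
    simp only [Matrix.mul_nonsing_inv_cancel_right _ _ hγP] at h'
    rw [Matrix.map_mul]
    exact h'
  have hUV' : U * V = 1 := by
    apply Matrix.map_injective (f := (PadicInt.Coe.ringHom : ℤ_[p] → ℚ_[p]))
      (fun x y hxy ↦ Subtype.coe_injective hxy)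
    show (U * V).map PadicInt.Coe.ringHom = (1 : Matrix (Fin n) (Fin n) ℤ_[p]).map PadicInt.Coe.ringHom
    rw [hUV, Matrix.map_one _ (map_zero _) (map_one _)]
  exact Matrix.isUnit_det_of_right_inverse hUV'

end Literature.Algebra.Module

end
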